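import Literature.IUT.HodgeArakelov.GoodPrimeKummerBridgeArchUnits
import Literature.IUT.HodgeArakelov.ArchRealifiedConstantMonoids
import HarnessLib

/-!
# [IUTchII] Prop 4.4 (ii) at archimedean primes, last clause: the natural poly-isomorphism
# `Ψ^ss_{†F^⊢_v} ⥲ Ψ^ss_cns(†D^⊢_v)` of semi-simplifications, CONSTRUCTED with all its members listed

S. Mochizuki, *Inter-universal Teichmüller theory II*, §4, kurims manuscript (Dec. 2020), Proposition 4.4 (ii)
pp. 129–130 (`v ∈ V^arc`), read on the page (lit key `paper:url-5036b4059555`, p. 130) [cite: Mochizuki2012, Prop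
4.4 (ii) p.130]. Claim key DISPUTED (D-0012). Printed (p. 130): "In particular, if we write
`Ψ^ss_{†F^⊢_v} := Ψ^×_{†F^⊢_v} × Ψ^R_{†F^⊢_v}` for the “semi-simplified version” of `Ψ_{†F^⊢_v}`, then the former distinguished
element, together with the poly-isomorphism of the first display of the present (ii), determine a natural
poly-isomorphism of topological monoids `Ψ^ss_{†F^⊢_v} ⥲ Ψ^ss_cns(†D^⊢_v)` [cf. Proposition 4.3, (ii)] that is
compatible with the natural splittings on the domain and codomain. Write `Ψ^ss_{†F_v} := Ψ^ss_{†F^⊢_v}`; thus, it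
follows from the definitions that we have a natural isomorphism `Ψ^ss_{†F_v} ⥲ Ψ^ss_{†F^⊢_v}`." Printed proof
(p. 131): "follow immediately from the definitions".

INPUTS (all in the tree, this seat's F9 files): the `{±1}`-orbit of isomorphisms of topological groups
`Ψ^×_{†F^⊢_v} ⥲ Ψ_cns(†D^⊢_v)^×` = `{φ^×, φ^× ∘ (−)⁻¹}` (`unitKummerTopIso_orbit`, p418015) and THE unique normalised
isomorphism of monoids `Ψ^R_{†F^⊢_v} = Ψ_{†F^⊢_v}/Ψ^×_{†F^⊢_v} ⥲ R_{≥0}(†D^⊢_v) = ℝ_{≥0}` (`realifiedIsoArch`,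
`existsUnique_realifiedIso`, p418389); `Ψ^ss_cns(†D^⊢_v) = Ψ_cns(†D^⊢_v)^× × R_{≥0}(†D^⊢_v)` is abc-iut-L6-t2's
`(ConstantMonoidDatum.ofArch X).SemiSimplified` (`HodgeTheaterKitBridge.lean`, `GaussianMonoidsGood.lean`).

WHAT THE KERNEL IS MADE TO SAY. `SemiSimplifiedArch X := X.OCˣ × Associates X.OC` is `Ψ^ss_{†F^⊢_v}` with its GENUINE
realified factor `Ψ_{†F^⊢_v}/Ψ^×_{†F^⊢_v}` (no identification with `ℝ≥0` presupposed); `semiSimplifiedPolyIso X` = the set of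
isomorphisms of monoids `Ψ^ss_{†F^⊢_v} ⥲ Ψ^ss_cns(†D^⊢_v)` of the form (an isomorphism of topological groups of the unit
groups) × (an isomorphism of the realified parts respecting the distinguished elements) — the printed
"poly-isomorphism … determined by" the two data; PROVED: it consists of EXACTLY the two members
`φ^× × ρ` and `(φ^× ∘ (−)⁻¹) × ρ` (`mem_semiSimplifiedPolyIso_iff`), each compatible with the splittings
(`semiSimplifiedPolyIso_unit`, `semiSimplifiedPolyIso_realified`), and its member `φ^× × ρ` is p415883's normalised
`semiSimplifiedKummerIso` after identifying `Ψ^R_{†F^⊢_v}` with `ℝ_{≥0}` by `ρ` (`prodCongr_unitKummer_eq`).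
`Ψ^ss_{†F_v} := Ψ^ss_{†F^⊢_v}` is a definitional abbreviation (no declaration).

HONEST FRAMING. Products of isomorphisms already in the tree; nothing here bears on [IUTchIII] Cor. 3.12 or
takes a side; typed ≠ discharged elsewhere.
-/

noncomputable section

open scoped _root_.NNReal

namespace Literature.IUT.HodgeArakelov

open Literature.IUT.HodgeTheaters

universe u

namespace GoodPrimeKummer

variable {Kv : Type u} [NormedField Kv] [NormedAlgebra ℝ Kv] (X : ArchLocalFrobenioid.{u} Kv)

/-- `Ψ^ss_{†F^⊢_v} := Ψ^×_{†F^⊢_v} × Ψ^R_{†F^⊢_v}`, "the “semi-simplified version” of `Ψ_{†F^⊢_v}`" ([IUTchII] Prop 4.4 (ii) p. 130),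
with `Ψ_{†F^⊢_v} = 𝒪^▷(†C^⊢_v) = X.OC`, `Ψ^× =` its unit group, `Ψ^R = Ψ/Ψ^×` (Mathlib's `Associates`) — the GENUINE
realified factor, before any identification with `ℝ_{≥0}`. (`Ψ^ss_{†F_v} := Ψ^ss_{†F^⊢_v}`, p. 130, is the same type.)
[cite: Mochizuki2012, Prop 4.4 (ii) p.130] -/
abbrev SemiSimplifiedArch : Type u := X.OCˣ × Associates X.OC

/-- **The natural poly-isomorphism `Ψ^ss_{†F^⊢_v} ⥲ Ψ^ss_cns(†D^⊢_v)` of [IUTchII] Prop 4.4 (ii)** (p. 130: "the former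
distinguished element, together with the poly-isomorphism of the first display of the present (ii), determine
a natural poly-isomorphism of topological monoids `Ψ^ss_{†F^⊢_v} ⥲ Ψ^ss_cns(†D^⊢_v)` … compatible with the natural
splittings"): the isomorphisms `ψ × ρ` with `ψ` an isomorphism of topological groups `Ψ^×_{†F^⊢_v} ⥲ Ψ_cns(†D^⊢_v)^×`
(a member of the unique `{±1}`-orbit) and `ρ` an isomorphism `Ψ^R_{†F^⊢_v} ⥲ R_{≥0}(†D^⊢_v)` carrying the distinguished
element (`p_v = e`) to `log^{†D^⊢_v}(p_v)`; target `Ψ^ss_cns(†D^⊢_v) = Ψ_cns(†D^⊢_v)^× × R_{≥0}(†D^⊢_v)` = abc-iut-L6-t2's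
`(ConstantMonoidDatum.ofArch X).SemiSimplified`. [cite: Mochizuki2012, Prop 4.4 (ii) p.130] -/
def semiSimplifiedPolyIso :
    Set (SemiSimplifiedArch X ≃* (ConstantMonoidDatum.ofArch X).SemiSimplified) :=
  {e | ∃ (ψ : X.OCˣ ≃ₜ* (unitDiscMonoid X.Afield)ˣ) (ρ : Associates X.OC ≃* Multiplicative ℝ≥0),
    ρ (archDistinguished X) = Multiplicative.ofAdd LogRealDatum.arch.logp ∧
      e = MulEquiv.prodCongr ψ.toMulEquiv ρ}

/-- The member `φ^× × ρ` of the poly-isomorphism: the unit part of the Kummer isomorphism of Prop 4.4 (i) times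
THE normalised realified isomorphism. [cite: Mochizuki2012, Prop 4.4 (ii) p.130] -/
def semiSimplifiedIsoArch : SemiSimplifiedArch X ≃* (ConstantMonoidDatum.ofArch X).SemiSimplified :=
  MulEquiv.prodCongr (unitKummerTopIso X).toMulEquiv (realifiedIsoArch X)

/-- The member `(φ^× ∘ (−)⁻¹) × ρ` of the poly-isomorphism. [cite: Mochizuki2012, Prop 4.4 (ii) p.130] -/
def semiSimplifiedIsoArchInv : SemiSimplifiedArch X ≃* (ConstantMonoidDatum.ofArch X).SemiSimplified :=
  MulEquiv.prodCongr ((unitKummerTopIso X).trans (invEquiv _)).toMulEquiv (realifiedIsoArch X)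

/-- `φ^× × ρ` belongs to the poly-isomorphism. [cite: Mochizuki2012, Prop 4.4 (ii) p.130] -/
theorem semiSimplifiedIsoArch_mem : semiSimplifiedIsoArch X ∈ semiSimplifiedPolyIso X :=
  ⟨unitKummerTopIso X, realifiedIsoArch X, realifiedIsoArch_distinguished X, rfl⟩

/-- `(φ^× ∘ (−)⁻¹) × ρ` belongs to the poly-isomorphism. [cite: Mochizuki2012, Prop 4.4 (ii) p.130] -/
theorem semiSimplifiedIsoArchInv_mem : semiSimplifiedIsoArchInv X ∈ semiSimplifiedPolyIso X :=
  ⟨(unitKummerTopIso X).trans (invEquiv _), realifiedIsoArch X, realifiedIsoArch_distinguished X, rfl⟩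

/-- **The poly-isomorphism `Ψ^ss_{†F^⊢_v} ⥲ Ψ^ss_cns(†D^⊢_v)` has EXACTLY the two members `φ^× × ρ`, `(φ^× ∘ (−)⁻¹) × ρ`** — the
`{±1}`-orbit of the unit part (p418015 `unitKummerTopIso_orbit`) times the UNIQUE normalised realified
isomorphism (p418389 `eq_realifiedIsoArch`). [cite: Mochizuki2012, Prop 4.4 (ii) p.130] -/
theorem mem_semiSimplifiedPolyIso_iff (e : SemiSimplifiedArch X ≃* (ConstantMonoidDatum.ofArch X).SemiSimplified) :
    e ∈ semiSimplifiedPolyIso X ↔ e = semiSimplifiedIsoArch X ∨ e = semiSimplifiedIsoArchInv X := by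
  constructor
  · rintro ⟨ψ, ρ, hρ, rfl⟩
    rw [eq_realifiedIsoArch X ρ hρ]
    rcases unitKummerTopIso_orbit X ψ with h | h
    · left
      rw [h]
      rfl
    · right
      rw [h]
      rfl
  · rintro (rfl | rfl)
    · exact semiSimplifiedIsoArch_mem X
    · exact semiSimplifiedIsoArchInv_mem X

/-- The two members are distinct (the `{±1}`-orbit of `φ^×` has two elements, p418015
`unitKummerTopIso_ne_trans_invEquiv`). [cite: Mochizuki2012, Prop 4.4 (ii) p.130] -/
theorem semiSimplifiedIsoArch_ne_inv : semiSimplifiedIsoArch X ≠ semiSimplifiedIsoArchInv X := by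
  intro h
  apply unitKummerTopIso_ne_trans_invEquiv X
  apply ContinuousMulEquiv.ext
  intro u
  have hu := MulEquiv.congr_fun h (u, 1)
  exact (Prod.ext_iff.1 hu).1

/-- "compatible with the natural splittings on the domain and codomain" — unit factor: every member carries
`Ψ^×_{†F^⊢_v} × {0}` into `Ψ_cns(†D^⊢_v)^× × {0}` (by an isomorphism of topological groups of the `{±1}`-orbit).
[cite: Mochizuki2012, Prop 4.4 (ii) p.130] -/
theorem semiSimplifiedPolyIso_unit {e : SemiSimplifiedArch X ≃* (ConstantMonoidDatum.ofArch X).SemiSimplified}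
    (he : e ∈ semiSimplifiedPolyIso X) :
    ∃ ψ : X.OCˣ ≃ₜ* (unitDiscMonoid X.Afield)ˣ, ∀ u : X.OCˣ, e (u, 1) = (ψ u, 1) := by
  obtain ⟨ψ, ρ, -, rfl⟩ := he
  exact ⟨ψ, fun u => Prod.ext rfl (map_one ρ)⟩

/-- … realified factor: every member carries `{1} × Ψ^R_{†F^⊢_v}` into `{1} × R_{≥0}(†D^⊢_v)` by THE normalised
isomorphism `realifiedIsoArch`. [cite: Mochizuki2012, Prop 4.4 (ii) p.130] -/
theorem semiSimplifiedPolyIso_realified {e : SemiSimplifiedArch X ≃* (ConstantMonoidDatum.ofArch X).SemiSimplified}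
    (he : e ∈ semiSimplifiedPolyIso X) (r : Associates X.OC) : e (1, r) = (1, realifiedIsoArch X r) := by
  obtain ⟨ψ, ρ, hρ, rfl⟩ := he
  rw [eq_realifiedIsoArch X ρ hρ]
  exact Prod.ext (map_one ψ.toMulEquiv) rfl

/-- Consistency with the place-independent normalised form (p415883 `semiSimplifiedKummerIso`, which presupposes
`Ψ^R ≅ ℝ_{≥0}` on both sides): identifying `Ψ^R_{†F^⊢_v}` with `ℝ_{≥0}` by `ρ` FIRST and then applying
`semiSimplifiedKummerIso` at the archimedean data with `φ^×` gives the member `φ^× × ρ`.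
[cite: Mochizuki2012, Prop 4.4 (ii) p.130] -/
theorem prodCongr_unitKummer_eq :
    (MulEquiv.prodCongr (MulEquiv.refl X.OCˣ) (realifiedIsoArch X)).trans
        (semiSimplifiedKummerIso (ConstantMonoidDatum.ofArch X) (CommGrpCat.of X.OCˣ) (archUnitKummerMulEquiv X)) =
      semiSimplifiedIsoArch X := by
  apply MulEquiv.ext
  intro x
  rfl

end GoodPrimeKummer

end Literature.IUT.HodgeArakelov

end
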